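import Summits.QuantumFields.YangMills.Theorems.TwistedTraceScaling.Negative.LabelLimitCompact
import HarnessLib

/-!
# The inverse-running-coupling form of LIM (R76): its single guard `1 ≤ β` is load-bearing, its depth sign is cosmetic, and it is a
# theorem lattice by lattice — crux disprover, cycle 63 (route `LuscherReduction`, crux `TwistedTraceScaling` stmt-QuantumFields-20203;
# `--supports`, helper only)

R76 (`Negative/LabelLimitCompact.lean`, `labelLimit_iff_invCouplingForm`) restated the window-free label limit LIM (⟺ the open stub
`TwoLattice.Stmt.stub_cmpTwoLoop`, R75) with the femto depth measured in the inverse running coupling: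
  X-FORM: `∀ s ε, ∃ X0 > 0, ∀ L ≥ 1, ∀ β, 1 ≤ β → X0 ≤ 1/ḡ²(β, L) → |r_L(β, ⌈sL/Λ(β,L)⌉) − r_𝔥(s)| ≤ ε`.
In this form the junk guard `0 < Λ(β, L)` of LIM has disappeared (it is implied by `0 < X0 ≤ 1/ḡ²`, ✓`R76.luscherLambda_le_of_le_invRunningCoupling`),
so the X-FORM carries ONE guard.  This file closes its guard analysis:

* ★ `invCouplingForm_false_without_betaGeOne` — **the guard `1 ≤ β` is load-bearing in the X-FORM too**: without it the text quantifies over the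
  strong-coupling root of the two-loop formula (`1/ḡ²(β, L) → +∞` as `β → 0⁺` through the `(b₁/b₀) log(2b₀/β)` term), where the lattice trace
  ratio is `≥ 1 − O(β·T)` while `r_𝔥(1) < 1` (✓`R75c.strongRoot_violates`); `invCouplingForm_false_without_betaGeOne_keeping_threshold` — a size
  threshold `∃ L0, ∀ L ≥ L0` does not rescue it (the strong root exists on every lattice).
* `invCouplingForm_iff_realThreshold` — the sign condition `0 < X0` is cosmetic (`∃ X0 : ℝ` gives the same statement: enlarge to `max X0 1`).
* ★ `invCouplingForm_pointwise` — **lattice by lattice the X-FORM is a theorem** (`X0 = X0(L, s, ε)`, from ✓`R75c.labelLimit_pointwise`): as for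
  LIM, the ENTIRE open content of the X-FORM (hence of CMP-2LOOP, ✓`R76.cmpTwoLoop_iff_invCouplingForm`) is the single quantifier swap
  `∃ X0 ∀ L` — one threshold on the two-loop scaling trajectory serving every cutoff.

HONEST FRAMING: guard/robustness facts about a hypothesis text equivalent to an OPEN stub of a child of the CONDITIONAL reduction route R2b1;
the crux `TwistedTraceScaling` is NOT refuted and NOT closed; fixed-lattice statements only — not infinite volume, not a mass gap, not Clay.
No definitions, no `sorry`.
-/

set_option autoImplicit false

noncomputable section

open MeasureTheory Filter Topology Real
open Literature.MathematicalPhysics.QuantumFieldTheory hiding SU2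
open Literature.MathematicalPhysics.QuantumLattice
open Literature.Analysis.OperatorTheory.YMMatrixModel
open scoped BigOperators

namespace Summit.QuantumFields.YangMills.Theorems.TwistedTraceScaling.Negative

open Summit.QuantumFields.YangMills.Theorems.FemtoTransferGap
open Summit.QuantumFields.YangMills.Theorems.FemtoTransferGap.TraceDoor
open Summit.QuantumFields.YangMills.Theorems.FemtoTransferGap.TT
open Summit.QuantumFields.YangMills.Theorems.FemtoTransferGap.TwoLattice

namespace R77

/-! ## §0 Conversions between a depth `Λ0` and a threshold `X0 = Λ0⁻³` -/

/-- `((X0⁻¹)^{1/3})³ = X0⁻¹` for `0 < X0`. -/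
theorem cbrt_inv_pow_three {X0 : ℝ} (hX0 : 0 < X0) : ((X0⁻¹) ^ ((1 : ℝ) / 3)) ^ 3 = X0⁻¹ := by
  rw [show ((1 : ℝ) / 3) = ((3 : ℕ) : ℝ)⁻¹ by norm_num]
  exact Real.rpow_inv_natCast_pow (by positivity) (by norm_num)

/-- `((Λ0³)⁻¹)⁻¹ ^ {1/3} = Λ0` for `0 ≤ Λ0`. -/
theorem cbrt_inv_inv_cube {Λ0 : ℝ} (hΛ0 : 0 ≤ Λ0) : (((Λ0 ^ 3)⁻¹)⁻¹) ^ ((1 : ℝ) / 3) = Λ0 := by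
  rw [inv_inv, show ((1 : ℝ) / 3) = ((3 : ℕ) : ℝ)⁻¹ by norm_num]
  exact Real.pow_rpow_inv_natCast hΛ0 (by norm_num)

/-! ## §1 ★ The single guard `1 ≤ β` of the X-FORM is load-bearing -/

/-- ★ **The X-FORM without `1 ≤ β` is false.**  At `s = 1`, `ε = (1 − r_𝔥(1))/4` and any threshold `X0 > 0`, the strong-coupling root `0 < β < 1`
of `Λ(β, 1) = lam ≤ (X0⁻¹)^{1/3}` on the one-site lattice (✓`R75c.strongRoot_violates`) satisfies `X0 ≤ 1/ḡ²(β, 1)`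
(✓`R76.inv_cube_le_invRunningCoupling`) and violates the inequality by more than `ε`.  [folklore] -/
theorem invCouplingForm_false_without_betaGeOne :
    ¬ (∀ s : ℝ, 0 < s → ∀ ε : ℝ, 0 < ε → ∃ X0 : ℝ, 0 < X0 ∧
        ∀ (L : ℕ) [NeZero L], ∀ β : ℝ, X0 ≤ invRunningCoupling β L →
          |traceRatio L β (femtoSteps s β L) - hTraceRatio s| ≤ ε) := by
  intro h
  have hg : 0 < (1 - hTraceRatio 1) / 4 := by linarith [hTraceRatio_lt_one one_pos]
  obtain ⟨X0, hX0, H⟩ := h 1 one_pos _ hg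
  obtain ⟨β, -, -, hpos, hle, hviol⟩ :=
    R75c.strongRoot_violates 1 (Λ0 := (X0⁻¹) ^ ((1 : ℝ) / 3)) (Real.rpow_pos_of_pos (by positivity) _)
  have hx : X0 ≤ invRunningCoupling β 1 := by
    have h1 := R76.inv_cube_le_invRunningCoupling hpos hle
    rwa [cbrt_inv_pow_three hX0, inv_inv] at h1
  exact absurd (H 1 β hx) (not_le.mpr hviol)

/-- **… and a size threshold does not rescue it**: `∃ X0, ∃ L0, ∀ L ≥ L0, ∀ β, X0 ≤ 1/ḡ² → …` (no `1 ≤ β`) is false as well — the strong root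
exists on the lattice `L = max(L0, 1)` (✓`R75c.strongRoot_violates` holds on every size).  [folklore] -/
theorem invCouplingForm_false_without_betaGeOne_keeping_threshold :
    ¬ (∀ s : ℝ, 0 < s → ∀ ε : ℝ, 0 < ε → ∃ X0 : ℝ, 0 < X0 ∧ ∃ L0 : ℕ,
        ∀ (L : ℕ) [NeZero L], L0 ≤ L → ∀ β : ℝ, X0 ≤ invRunningCoupling β L →
          |traceRatio L β (femtoSteps s β L) - hTraceRatio s| ≤ ε) := by
  intro h
  have hg : 0 < (1 - hTraceRatio 1) / 4 := by linarith [hTraceRatio_lt_one one_pos]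
  obtain ⟨X0, hX0, L0, H⟩ := h 1 one_pos _ hg
  haveI : NeZero (max L0 1) := ⟨(lt_max_of_lt_right Nat.one_pos).ne'⟩
  obtain ⟨β, -, -, hpos, hle, hviol⟩ :=
    R75c.strongRoot_violates (max L0 1) (Λ0 := (X0⁻¹) ^ ((1 : ℝ) / 3)) (Real.rpow_pos_of_pos (by positivity) _)
  have hx : X0 ≤ invRunningCoupling β (max L0 1) := by
    have h1 := R76.inv_cube_le_invRunningCoupling hpos hle
    rwa [cbrt_inv_pow_three hX0, inv_inv] at h1
  exact absurd (H (max L0 1) (le_max_left _ _) β hx) (not_le.mpr hviol)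

/-! ## §2 The sign condition on the threshold is cosmetic -/

/-- The X-FORM with `∃ X0 : ℝ` (no sign) is the same statement as with `∃ X0 > 0`: a threshold may always be enlarged to `max X0 1 > 0`. -/
theorem invCouplingForm_iff_realThreshold :
    (∀ s : ℝ, 0 < s → ∀ ε : ℝ, 0 < ε → ∃ X0 : ℝ, 0 < X0 ∧
      ∀ (L : ℕ) [NeZero L], ∀ β : ℝ, 1 ≤ β → X0 ≤ invRunningCoupling β L →
        |traceRatio L β (femtoSteps s β L) - hTraceRatio s| ≤ ε) ↔
    (∀ s : ℝ, 0 < s → ∀ ε : ℝ, 0 < ε → ∃ X0 : ℝ,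
      ∀ (L : ℕ) [NeZero L], ∀ β : ℝ, 1 ≤ β → X0 ≤ invRunningCoupling β L →
        |traceRatio L β (femtoSteps s β L) - hTraceRatio s| ≤ ε) := by
  constructor
  · intro h s hs ε hε
    obtain ⟨X0, -, H⟩ := h s hs ε hε
    exact ⟨X0, H⟩
  · intro h s hs ε hε
    obtain ⟨X0, H⟩ := h s hs ε hε
    exact ⟨max X0 1, lt_of_lt_of_le one_pos (le_max_right _ _),
      fun L _ β hβ hx => H L β hβ ((le_max_left _ _).trans hx)⟩

/-! ## §3 ★ Lattice by lattice the X-FORM is a theorem: its open content is the swap `∃ X0 ∀ L` -/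

/-- ★ **Pointwise X-FORM.**  For every FIXED lattice size `L ≥ 1`: `∀ s ε, ∃ X0(L, s, ε) > 0, ∀ β ≥ 1, X0 ≤ 1/ḡ²(β, L) → |r_L − r_𝔥(s)| ≤ ε`
(✓`R75c.labelLimit_pointwise` with `X0 = Λ0(L, s, ε)⁻³`, ✓`R76.luscherLambda_le_of_le_invRunningCoupling`).  Hence, exactly as for LIM, the only
open content of the X-FORM — and of CMP-2LOOP (✓`R76.cmpTwoLoop_iff_invCouplingForm`) — is ONE threshold `X0(s, ε)` on the two-loop scaling
trajectory serving EVERY cutoff `L`.  [cite: LuscherMunster1984, §2] -/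
theorem invCouplingForm_pointwise (L : ℕ) [NeZero L] :
    ∀ s : ℝ, 0 < s → ∀ ε : ℝ, 0 < ε → ∃ X0 : ℝ, 0 < X0 ∧
      ∀ β : ℝ, 1 ≤ β → X0 ≤ invRunningCoupling β L →
        |traceRatio L β (femtoSteps s β L) - hTraceRatio s| ≤ ε := by
  intro s hs ε hε
  obtain ⟨Λ0, hΛ0, H⟩ := R75c.labelLimit_pointwise L s hs ε hε
  refine ⟨(Λ0 ^ 3)⁻¹, by positivity, fun β hβ hx => ?_⟩
  obtain ⟨hpos, hle⟩ := R76.luscherLambda_le_of_le_invRunningCoupling (by positivity) hx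
  rw [cbrt_inv_inv_cube hΛ0.le] at hle
  exact H β hβ hpos hle

/-- **The X-FORM follows from its own `L`-pointwise version plus ONE uniformity datum** — an `L`-independent bound `X̄(s, ε)` on the pointwise
thresholds: if some choice of pointwise thresholds is bounded in `L`, the X-FORM holds.  (Tautological packaging of the swap; recorded so that a
planner sees the open content as "the pointwise thresholds `X0(L, s, ε)` may be chosen bounded in `L`".) -/
theorem invCouplingForm_of_bounded_pointwise
    (h : ∀ s : ℝ, 0 < s → ∀ ε : ℝ, 0 < ε → ∃ Xbar : ℝ, ∀ (L : ℕ) [NeZero L], ∃ X0 : ℝ, X0 ≤ Xbar ∧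
      ∀ β : ℝ, 1 ≤ β → X0 ≤ invRunningCoupling β L →
        |traceRatio L β (femtoSteps s β L) - hTraceRatio s| ≤ ε) :
    ∀ s : ℝ, 0 < s → ∀ ε : ℝ, 0 < ε → ∃ X0 : ℝ, 0 < X0 ∧
      ∀ (L : ℕ) [NeZero L], ∀ β : ℝ, 1 ≤ β → X0 ≤ invRunningCoupling β L →
        |traceRatio L β (femtoSteps s β L) - hTraceRatio s| ≤ ε := by
  intro s hs ε hε
  obtain ⟨Xbar, H⟩ := h s hs ε hε
  refine ⟨max Xbar 1, lt_of_lt_of_le one_pos (le_max_right _ _), fun L _ β hβ hx => ?_⟩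
  obtain ⟨X0, hX0, HL⟩ := H L
  exact HL β hβ (hX0.trans ((le_max_left _ _).trans hx))

/-- **CMP-2LOOP without `1 ≤ β`, in the X-FORM, is false** (stub-level reading of `invCouplingForm_false_without_betaGeOne`): the registered stub is
equivalent to the X-FORM (✓`R76.cmpTwoLoop_iff_invCouplingForm`), and the X-FORM minus its guard is refuted — so a rev-4 text in the X-FORM must keep
`1 ≤ β` (or any `β ≥ β_min > 0` cut excluding the strong root; cf. ✓`R75b.labelLimit_guards_load_bearing`). [folklore] -/
theorem cmpTwoLoop_invCouplingForm_guard :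
    (Stmt.stub_cmpTwoLoop ↔
      (∀ s : ℝ, 0 < s → ∀ ε : ℝ, 0 < ε → ∃ X0 : ℝ, 0 < X0 ∧
        ∀ (L : ℕ) [NeZero L], ∀ β : ℝ, 1 ≤ β → X0 ≤ invRunningCoupling β L →
          |traceRatio L β (femtoSteps s β L) - hTraceRatio s| ≤ ε)) ∧
    ¬ (∀ s : ℝ, 0 < s → ∀ ε : ℝ, 0 < ε → ∃ X0 : ℝ, 0 < X0 ∧
        ∀ (L : ℕ) [NeZero L], ∀ β : ℝ, X0 ≤ invRunningCoupling β L →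
          |traceRatio L β (femtoSteps s β L) - hTraceRatio s| ≤ ε) :=
  ⟨R76.cmpTwoLoop_iff_invCouplingForm, invCouplingForm_false_without_betaGeOne⟩

end R77

end Summit.QuantumFields.YangMills.Theorems.TwistedTraceScaling.Negative

end
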